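import Summits.BirchSwinnertonDyer.BirchSwinnertonDyer.Theorems.EisensteinPrimesBSDpOnCellCResidualV11
import HarnessLib

/-!
# Crux 4 `BSDpOnCellC` (stmt-BirchSwinnertonDyer-19034) — line b1, SKELETON v12 DRAFT (cell `bsd-eis`, width seat
# `bsd-line-x2-p2` gen 3, 2026-08-28; the skeleton OF RECORD is v11 aa11a952… (this seat, host GO planner g28
# RULING L113 (3)) until the host / a LEAD rules GO on this file (W-79).
#
# THE ONE CHANGE (the halves v15 → v16 pattern: after a piece goes kernel / by-name, the stubs are re-cut so that
# the REGISTERED STUB LIST = THE HONEST RESIDUAL BY NAME): v11's `stub_muSelmer` and `stub_lambdaLowerBound` are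
# NO LONGER STUBS — both follow BY NAME (p622336, p622724) from ONE named preprint fact + ONE inline imprimitive
# count, which become the stubs instead:
#   `stub_lemma511`          — `KellerYin2024.lemma511_imprimitive_isTorsion_muInvariant_eq_zero_mult_OPEN` VERBATIM
#                               (Keller–Yin v2 Lemma 5.1.1, member-f half; PRE named fact, p621903);
#   `stub_imprimitiveCount`  — both signs: ∀ X2c datum, ∀ `Sf` = places of `K` over `N_E` off `p`, ∀ m: the frame
#                               `Q` has its first unit coefficient at `m` ⟹ `m + Σ_{w∈Sf} curveLocalLambda κ E_K w
#                               ≤ λ(X_ac^{Sf} strict at 𝔭̄)` (print: `λ(𝓛^S_f) ≤ λ(𝔛^S_f)`, Keller–Yin Lemma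
#                               5.1.2's `λ`-consequence; PRE, printed proof gapped at L1754 — THE WALL).
# `stub_publishedFacts`, `stub_divRbeta`, `stub_muFrame`, `stub_mazurMC_cellB` BYTE-IDENTICAL to v11. Stubs 6 → 6.
# Composition `BSDpOnCellC_of` = `BSDpOnCellCResidualV11.bsdpOnCellC_of_publishedFacts_of_divIntOther_of_lemma511_OPEN
# _of_muFrame_of_imprimitiveCount_of_cellB` (this seat), i.e. p613384 ∘ (p622336, p622724 ∘ p620653). The crux's
# honest residual is UNCHANGED IN SUBSTANCE; the f-side `S`-relaxation and `μ(𝔛^S)=0 ⇒ μ(𝔛^∅)=0` left the stub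
# list for the kernel. Nothing mathematical is new; no census sentence, label or count changes.

HONEST FRAMING (cell `bsd-eis`, run/shared/lean/pub/bsd-eis/): a crux workfile DRAFT, NOT a proposal; nothing is
booked; X2 stays CONSTRUCTION-SHAPED; no label or count moves; BSD is proved for no curve.
-/

set_option autoImplicit false
set_option linter.dupNamespace false

noncomputable section

open scoped Classical MatrixGroups ModularForm

open CongruenceSubgroup WeierstrassCurve NumberField IsDedekindDomain Field PowerSeries
  Literature.NumberTheory.EllipticCurves Literature.NumberTheory.EllipticCurves.GreenbergSelmer
  Literature.NumberTheory.EllipticCurves.ModularForms Literature.NumberTheory.QuadraticFields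
  Literature.NumberTheory.EllipticCurves.Rank1Residual
  Literature.NumberTheory.EllipticCurves.Rank1Residual.Typed
  Literature.NumberTheory.EllipticCurves.KrizLi2019
  Literature.NumberTheory.EllipticCurves.GreenbergVatsal2000
  Literature.NumberTheory.EllipticCurves.Wuthrich2014
  Literature.NumberTheory.EllipticCurves.SteinWuthrich2013
  Literature.NumberTheory.EllipticCurves.Castella2018Exceptional
  Literature.NumberTheory.GaloisRepresentations Literature.NumberTheory.GaloisCohomology
  Literature.NumberTheory.Automorphic
  Summit.BirchSwinnertonDyer.Rank1Residual.X11b.AcSelmer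
  Summit.BirchSwinnertonDyer.Rank1Residual.X11b.Halves
  Summit.BirchSwinnertonDyer.Rank1Residual.X11b
  Summit.BirchSwinnertonDyer.Rank1Residual Summit.BirchSwinnertonDyer.Rank1Residual.X1
  Summit.BirchSwinnertonDyer.Rank1Residual.X2
open Literature.NumberTheory.EllipticCurves.KellerYin2024 (curveLocalLambda)


namespace Summit.BirchSwinnertonDyer.BirchSwinnertonDyer.Cruxes.BSDpOnCellC.B1

/-- **stub_publishedFacts** [fact-grade; each conjunct a REGISTERED Literature `Prop` with its cite
tag, NONE of them proved in the tree at registration of v8.1]: the 16 still-unproved published inputs of the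
class theorems — 15 of v5's 23 (GV 2000 λ/μ at a multiplicative prime; Wuthrich 2014 Thm 16; Stein–Wuthrich
2013 Thm 6.1 both signs; Greenberg–Stevens; newform existence (modularity "Version L"); Poitou–Tate ×2;
Hsieh 2014 Thm 1; Gross–Zagier; Kolyvagin; rank = analytic rank ≤ 1; Hoffstein–Luo / BFH non-vanishing
twist; Mazur on the Manin constant; Cassels isogeny invariance) as ONE conjunction, AND the 16th: Castella
JIMJ 17 (2018) Thms. 2.10–2.11 at weight 2 in BDP 2013's display (`thm210_thm211_bdpDisplay_pNew`, p435419;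
p ≥ 5, p ‖ N, a_p symbolic, no image hypothesis). REMOVED v8 → v8.1 because PROVED (supplied by name in
`BSDpOnCellC_of`): modular parametrisation data (⇐ newform existence,
`nonempty_modularParametrizationData_iff_exists_isNewformOf_unconditional`), Tate's local Euler–Poincaré
characteristic (`X11b.LocBridge.localEulerPoincareCharacteristic_adicCompletionEP`), Brink's anticyclotomic lemma
(`ZpExtension.decomp_not_le_kerSubgroup_of_isAnticyclotomic_holds`), Edixhoven's integrality
(`ModularForms.edixhoven_optimalManinConstant_integral_holds`). REMOVED v7 → v8: Stein–Wuthrich 2013 §4.2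
canonical heights at a split / non-split multiplicative p (`exists_isSplitMultCanonical_holds` p457358,
`exists_isMultCanonical_holds` p464598 — k5-c4 g3, via Silverman ATAEC V.3.2(b)(i) proved as
`TateCurve.tate_thetaRelation`), `cd ≤ 2` (`fieldCdLE_two_of_numberField_holds`), Heegner-point rationality
(`heegnerPointComplex_mem_range_map_holds`). [cite: Hsieh2014, Thm. 1] [cite: GreenbergVatsal2000, Thm. (1.3)]
[cite: SteinWuthrich2013, Thm. 6.1] [cite: Castella2018Exceptional, Thm. 2.10 and Thm. 2.11 (arXiv:1507.04260 pp. 13–14)]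
[cite: LiuZhangZhang2018, Thm. 1.5.1 and Remark 1.1.2 and Thm. 1.5.3 (Duke Math. J. 167 pp. 745–749)] -/
theorem stub_publishedFacts :
    ((lambdaMu_multiplicative_of_gvPar ∧ thm16_charIdeal_dvd_multiplicative_of_reducible ∧
    thm61_splitMultiplicative ∧ thm61_nonsplitMultiplicative ∧
    (∀ (W : WeierstrassCurve ℚ) [W.IsElliptic] [W.IsGloballyMinimal] (p : ℕ) [Fact p.Prime],
      greenberg_stevens (W := W) (p := p)) ∧
    exists_isNewformOf ∧
    (∀ (K : Type) [Field K] [NumberField K], poitouTate_selmerStructure_duality K) ∧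
    (∀ (K : Type) [Field K] [NumberField K], poitouTate_sha_tateDual K) ∧
    hsieh2014_exists_anticyclotomicPAdicLFunction ∧
    (∀ (N : ℕ) [NeZero N] (W : WeierstrassCurve ℚ) (K : Type) [Field K] [NumberField K],
      gross_zagier N W K) ∧
    (∀ (N : ℕ) [NeZero N] (W : WeierstrassCurve ℚ) (K : Type) [Field K] [NumberField K],
      kolyvagin N W K) ∧
    rank_eq_analyticRank_of_analyticRank_le_one ∧ HoffsteinLuo1997_exists_twist_L_one_ne_zero ∧
    mazur_not_dvd_maninConstant_of_odd ∧ bsdRHS_eq_of_isIsogenous) ∧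
    thm210_thm211_bdpDisplay_pNew) ∧
    LiuZhangZhang2018.thm151_thm153_modularCurve_heegnerVector := by
  sorry

/-- **stub_divRbeta** [road R-β at `𝔭̄`, both signs, BY NAME: the reducible Heegner-point Kolyvagin
divisibility `Ch_Λ(X_ac^∅(E_K[p^∞]) STRICT AT 𝔭̄)·𝓞_{ℂ_p}⟦T⟧ ∋ p^k · Q` for every ♭-frame `Q` at `(ι′, 𝔭)`
(`X2.NonsplitKolyvaginDivOnTreeIntOther` / `X2.SplitKolyvaginDivOnTreeIntOther`, c3h g4 p489067). PRINT STATUS: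
unprinted at a residually REDUCIBLE `p ‖ N` (Keller–Yin §3 `Koly` is for good `p`; CGS 2025 Thm. 6.5.2 has the §6
standing `p ∤ 2N`; Castella arXiv:2409.01360 Thm. 1.3 (i) is the irreducible locus); its consequence
`λ(X_ac^∅) ≤ λ(𝓛)` is FREE (`StubC3InvariantTransfers.lambdaInvariant_le_of_divIntOther`, p613908).]
[claim: KellerYin2024, status: under-review]
[cite: KellerYin2024, §3 and Thm. 5.1.3 = Thm. D (arXiv:2402.12781v2) (shape only; nothing asserted)]
[cite: CastellaGrossiSkinner2025, Thm. 6.5.2 (Math. Ann. 393, final TeX l.3231–3238; good ordinary `p` only)] -/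
theorem stub_divRbeta :
    (∀ (W : WeierstrassCurve ℚ) [W.IsElliptic] [W.IsGloballyMinimal] (p : ℕ) [Fact p.Prime],
      CellC W p → ¬ W.HasSplitMultiplicativeReductionAtPrime p → NonsplitKolyvaginDivOnTreeIntOther W p) ∧
    (∀ (W : WeierstrassCurve ℚ) [W.IsElliptic] [W.IsGloballyMinimal] (p : ℕ) [Fact p.Prime],
      CellC W p → W.HasSplitMultiplicativeReductionAtPrime p → SplitKolyvaginDivOnTreeIntOther W p) := by
  sorry

/-- **stub_lemma511** [a NAMED PREPRINT FACT as stub: Keller–Yin arXiv:2402.12781v2 §5.1 Lemma 5.1.1 (TeX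
L1744–1749), member-`f` half — `KellerYin2024.lemma511_imprimitive_isTorsion_muInvariant_eq_zero_mult_OPEN` VERBATIM
(typed by this seat, `Literature/…/KellerYin2024/MultiplicativeImprimitiveMuInvariant.lean`, p621903; lit desk T144
FAITHFUL-as-declared, flags KY511-S / KYD-Sel / KY511-tors / KY511-h1): at `2 < p`, `Mult`, `Red`, `K` as in KY
§0.1, `vbar ∋ p`, `κ` anticyclotomic, `Sf` = places over `N_E` off `p`, the `Sf`-imprimitive dual
`AcSelmer.XAc (W.baseChange K) p κ vbar ↑Sf γ` is `Λ`-torsion with `μ = 0`. It supplies v11's `stub_muSelmer`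
(p622336) and the torsion/`μ` half of the imprimitive cut (p622724). Flag KY511-h1: at members with a rational
`p`-torsion point the instance rests on Lemma 5.1.1 + KY's lattice-independence sentence L1070–1074. Closing it =
proving Keller–Yin's Lemma 5.1.1 (the Greenberg–Vatsal/Keller–Yin imprimitive devissage) in the tree.]
[claim: KellerYin2024, status: under-review]
[cite: KellerYin2024, Lemma 5.1.1 (arXiv:2402.12781v2 §5.1 TeX L1744–1749), Thm. 1.4.1 (L1087–1098)] -/
theorem stub_lemma511 :
    Literature.NumberTheory.EllipticCurves.KellerYin2024.lemma511_imprimitive_isTorsion_muInvariant_eq_zero_mult_OPEN := by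
  sorry

/-- **stub_muFrame** [the ANALYTIC half of the «μ = 0 pair», both signs: at every X2c datum, every ♭-frame
`Q ∈ 𝓞_{ℂ_p}⟦T⟧` of the BDP `p`-adic `L`-function at `(ι′, 𝔭)` (`R1.IsBDPLFunctionInt`, Hsieh's receptacle) HAS a
first unit coefficient: `∃ m, ‖Q_m‖ = 1 ∧ ∀ i < m, ‖Q_i‖ < 1` — i.e. `μ(𝓛^BDP_𝔭) = 0` in the wide receptacle
(`StubC3MuLambdaInvariants.firstUnitCoeff_map_toCpInt_iff_mu_eq_zero_and_lam_eq` is the `ℤ_p`-dictionary). PRINT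
STATUS: at a residually REDUCIBLE `p ‖ N` no printed statement (Hsieh 2014 Thm. B / Castella–Hsieh need `ρ̄`
irreducible; CGLS 2022 Thm. 2.2.2 / Keller–Yin Thm. 2.2.2 carry `p ∤ N`; Keller–Yin §5.1 (b) reaches `𝓛^S_f` mod
`𝔪^m` through Castella's two-variable `p`-adic `L`-function instead).] [claim: KellerYin2024, status: under-review]
[cite: KellerYin2024, Thm. 2.2.2 and §5.1 (b) (arXiv:2402.12781v2) (shape only; nothing asserted)]
[cite: Hsieh2014, Thm. 1 and Thm. B (Doc. Math. 19)] -/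
theorem stub_muFrame :
    (∀ (W : WeierstrassCurve ℚ) [W.IsElliptic] [W.IsGloballyMinimal] (p : ℕ) [Fact p.Prime],
      ∀ (N : ℕ) [NeZero N] (K : Type) [Field K] [NumberField K] (Dt : ModularParametrizationData W N)
        (H : HeegnerDatum N (NumberField.discr K)) (ιK : K →+* ℂ) (P : (W.baseChange K).toAffine.Point),
        CellC W p → ¬ W.HasSplitMultiplicativeReductionAtPrime p → W.conductorNorm ℤ = N →
        IsImaginaryQuadratic K → NumberField.discr K < -4 → SatisfiesHeegnerHypothesis N K →
        (W.quadraticTwist (NumberField.discr K : ℚ)).entireLFunction 1 ≠ 0 →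
        WeierstrassCurve.Affine.Point.map ιK.toRatAlgHom P = heegnerPointComplex Dt H →
        ¬ (p : ℤ) ∣ Dt.c → ¬ IsOfFinAddOrder P →
        Odd (NumberField.discr K) →
        ∀ (κ : ZpExtension K p), κ.IsAnticyclotomic →
          ∀ (γ : Field.absoluteGaloisGroup K) [Fact (κ.IsTopGenerator γ)]
            (𝔭 : HeightOneSpectrum (𝓞 K)), ((p : ℕ) : 𝓞 K) ∈ 𝔭.asIdeal →
            𝔭.asIdeal.ramificationIdx (𝓞 ℚ) = 1 → 𝔭.asIdeal.inertiaDeg (𝓞 ℚ) = 1 →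
            ∀ (𝔭bar : HeightOneSpectrum (𝓞 K)), ((p : ℕ) : 𝓞 K) ∈ 𝔭bar.asIdeal → 𝔭bar ≠ 𝔭 →
              ((Ideal.span {(p : ℤ)}).primesOver (𝓞 K)).ncard = 2 →
            ∀ (f : CuspForm (CongruenceSubgroup.Gamma0 N) 2), IsNewformOf W f →
              ∀ (ι' : PadicAlgCl p ≃+* ℂ),
                (∀ (w : InfinitePlace K) (k : 𝓞 K),
                  k ∈ 𝔭.asIdeal ↔ ‖ι'.symm (w.embedding (k : K))‖ < 1) →
                ∀ (ΩK : ℂ) (Ωp : ℂ_[p]) (Q : PowerSeries 𝓞_ℂ_[p]), ΩK ≠ 0 → ‖Ωp‖ = 1 →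
                  R1.IsBDPLFunctionInt p ι' 𝔭 κ γ f ΩK Ωp Q →
                    ∃ m : ℕ, ‖((PowerSeries.coeff m Q : 𝓞_ℂ_[p]) : ℂ_[p])‖ = 1 ∧
                  ∀ i < m, ‖((PowerSeries.coeff i Q : 𝓞_ℂ_[p]) : ℂ_[p])‖ < 1) ∧
    (∀ (W : WeierstrassCurve ℚ) [W.IsElliptic] [W.IsGloballyMinimal] (p : ℕ) [Fact p.Prime],
      ∀ (N : ℕ) [NeZero N] (K : Type) [Field K] [NumberField K] (Dt : ModularParametrizationData W N)
        (H : HeegnerDatum N (NumberField.discr K)) (ιK : K →+* ℂ) (P : (W.baseChange K).toAffine.Point),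
        CellC W p → W.HasSplitMultiplicativeReductionAtPrime p → W.conductorNorm ℤ = N →
        IsImaginaryQuadratic K → NumberField.discr K < -4 → SatisfiesHeegnerHypothesis N K →
        (W.quadraticTwist (NumberField.discr K : ℚ)).entireLFunction 1 ≠ 0 →
        WeierstrassCurve.Affine.Point.map ιK.toRatAlgHom P = heegnerPointComplex Dt H →
        ¬ (p : ℤ) ∣ Dt.c → ¬ IsOfFinAddOrder P →
        Odd (NumberField.discr K) →
        ∀ (κ : ZpExtension K p), κ.IsAnticyclotomic →
          ∀ (γ : Field.absoluteGaloisGroup K) [Fact (κ.IsTopGenerator γ)]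
            (𝔭 : HeightOneSpectrum (𝓞 K)), ((p : ℕ) : 𝓞 K) ∈ 𝔭.asIdeal →
            𝔭.asIdeal.ramificationIdx (𝓞 ℚ) = 1 → 𝔭.asIdeal.inertiaDeg (𝓞 ℚ) = 1 →
            ∀ (𝔭bar : HeightOneSpectrum (𝓞 K)), ((p : ℕ) : 𝓞 K) ∈ 𝔭bar.asIdeal → 𝔭bar ≠ 𝔭 →
              ((Ideal.span {(p : ℤ)}).primesOver (𝓞 K)).ncard = 2 →
            ∀ (f : CuspForm (CongruenceSubgroup.Gamma0 N) 2), IsNewformOf W f →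
              ∀ (ι' : PadicAlgCl p ≃+* ℂ),
                (∀ (w : InfinitePlace K) (k : 𝓞 K),
                  k ∈ 𝔭.asIdeal ↔ ‖ι'.symm (w.embedding (k : K))‖ < 1) →
                ∀ (ΩK : ℂ) (Ωp : ℂ_[p]) (Q : PowerSeries 𝓞_ℂ_[p]), ΩK ≠ 0 → ‖Ωp‖ = 1 →
                  R1.IsBDPLFunctionInt p ι' 𝔭 κ γ f ΩK Ωp Q →
                    ∃ m : ℕ, ‖((PowerSeries.coeff m Q : 𝓞_ℂ_[p]) : ℂ_[p])‖ = 1 ∧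
                  ∀ i < m, ‖((PowerSeries.coeff i Q : 𝓞_ℂ_[p]) : ℂ_[p])‖ < 1) := by
  sorry

/-- **stub_imprimitiveCount** [THE WALL on line b1, at the IMPRIMITIVE level, both signs: at every X2c datum, for
`Sf` = the places of `K` over `N_E` NOT over `p` (Keller–Yin's `S = Σ ∖ {v, v̄, ∞}`) and every `m` at which the ♭-frame
`Q` has its first unit coefficient, `m + Σ_{w∈Sf} curveLocalLambda κ E_K w ≤ λ(X_ac^{Sf}(E_K[p^∞]) strict at 𝔭̄)` —
in print's currency `λ(𝓛^S_f) ≤ λ(𝔛^S_f)` with `𝓛^S_f := 𝓛_f · ∏_{w∈S} 𝒫_w(f)` (KY §0.2 L267–268) and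
`λ𝒫_w(f) = curveLocalLambda` (tree D3 dictionary). From it + `stub_lemma511` the primitive wall `λ(𝓛) ≤ λ(X_ac^∅)`
(v11 `stub_lambdaLowerBound`) follows BY NAME (`StubC3ImprimitiveCut`, p622724), the f-side `S`-relaxation
`λ(X^{Sf}) ≤ λ(X^∅) + Σ curveLocalLambda` being KERNEL at `p ‖ N` (p564629 + p620653). PRINT STATUS: the
`λ`-consequence of Keller–Yin Lemma 5.1.2 (`Char(𝔛^S_f)Λ^nr = (𝓛^S_f)`, L1750–1769, the imprimitive main
conjecture delivered by the Hida-family congruence limit) — PREPRINT, printed proof GAPPED at L1754 (kernel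
counterexample `X2.KellerYinFreePartGap`, flag KYD-gap; the repair needs lattice congruences `T_{f_m}/ϖ^m ≅ T_f/ϖ^m`
for residually reducible `f`, not in print); on the GV/CGLS road it is [ALG-imp at `p ‖ N`] + [PWL-θ] + [Thm 2.2.2 at
`p ‖ N`, unprinted] + Rubin–Hida. Inline (no `𝓛^S` object for Hsieh's receptacle), not a named fact.]
[claim: KellerYin2024, status: under-review]
[cite: KellerYin2024, Lemma 5.1.2 (L1750–1769), §0.2 L246 and L267–268, Thm. 1.5.1, Thm. 2.2.2 (arXiv:2402.12781v2) (shape only)]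
[cite: GreenbergVatsal2000, §2 Prop. (2.4)] -/
theorem stub_imprimitiveCount :
    (∀ (W : WeierstrassCurve ℚ) [W.IsElliptic] [W.IsGloballyMinimal] (p : ℕ) [Fact p.Prime],
      ∀ (N : ℕ) [NeZero N] (K : Type) [Field K] [NumberField K] (Dt : ModularParametrizationData W N)
        (H : HeegnerDatum N (NumberField.discr K)) (ιK : K →+* ℂ) (P : (W.baseChange K).toAffine.Point),
        CellC W p → ¬ W.HasSplitMultiplicativeReductionAtPrime p → W.conductorNorm ℤ = N →
        IsImaginaryQuadratic K → NumberField.discr K < -4 → SatisfiesHeegnerHypothesis N K →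
        (W.quadraticTwist (NumberField.discr K : ℚ)).entireLFunction 1 ≠ 0 →
        WeierstrassCurve.Affine.Point.map ιK.toRatAlgHom P = heegnerPointComplex Dt H →
        ¬ (p : ℤ) ∣ Dt.c → ¬ IsOfFinAddOrder P →
        Odd (NumberField.discr K) →
        ∀ (κ : ZpExtension K p), κ.IsAnticyclotomic →
          ∀ (γ : Field.absoluteGaloisGroup K) [Fact (κ.IsTopGenerator γ)]
            (𝔭 : HeightOneSpectrum (𝓞 K)), ((p : ℕ) : 𝓞 K) ∈ 𝔭.asIdeal →
            𝔭.asIdeal.ramificationIdx (𝓞 ℚ) = 1 → 𝔭.asIdeal.inertiaDeg (𝓞 ℚ) = 1 →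
            ∀ (𝔭bar : HeightOneSpectrum (𝓞 K)), ((p : ℕ) : 𝓞 K) ∈ 𝔭bar.asIdeal → 𝔭bar ≠ 𝔭 →
              ((Ideal.span {(p : ℤ)}).primesOver (𝓞 K)).ncard = 2 →
            ∀ (f : CuspForm (CongruenceSubgroup.Gamma0 N) 2), IsNewformOf W f →
              ∀ (ι' : PadicAlgCl p ≃+* ℂ),
                (∀ (w : InfinitePlace K) (k : 𝓞 K),
                  k ∈ 𝔭.asIdeal ↔ ‖ι'.symm (w.embedding (k : K))‖ < 1) →
                ∀ (ΩK : ℂ) (Ωp : ℂ_[p]) (Q : PowerSeries 𝓞_ℂ_[p]), ΩK ≠ 0 → ‖Ωp‖ = 1 →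
                  R1.IsBDPLFunctionInt p ι' 𝔭 κ γ f ΩK Ωp Q →
                    ∀ (Sf : Finset (HeightOneSpectrum (𝓞 K))),
                    (∀ w : HeightOneSpectrum (𝓞 K), w ∈ Sf ↔
                      (((W.conductorNorm ℤ : ℤ) : 𝓞 K) ∈ w.asIdeal ∧ ((p : ℕ) : 𝓞 K) ∉ w.asIdeal)) →
                    ∀ m : ℕ, ‖((PowerSeries.coeff m Q : 𝓞_ℂ_[p]) : ℂ_[p])‖ = 1 →
                      (∀ i < m, ‖((PowerSeries.coeff i Q : 𝓞_ℂ_[p]) : ℂ_[p])‖ < 1) →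
                        m + ∑ w ∈ Sf, curveLocalLambda κ (W.baseChange K) w ≤
                          lambdaInvariant p (XAc (W.baseChange K) p κ 𝔭bar (↑Sf : Set (HeightOneSpectrum (𝓞 K))) γ)) ∧
    (∀ (W : WeierstrassCurve ℚ) [W.IsElliptic] [W.IsGloballyMinimal] (p : ℕ) [Fact p.Prime],
      ∀ (N : ℕ) [NeZero N] (K : Type) [Field K] [NumberField K] (Dt : ModularParametrizationData W N)
        (H : HeegnerDatum N (NumberField.discr K)) (ιK : K →+* ℂ) (P : (W.baseChange K).toAffine.Point),
        CellC W p → W.HasSplitMultiplicativeReductionAtPrime p → W.conductorNorm ℤ = N →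
        IsImaginaryQuadratic K → NumberField.discr K < -4 → SatisfiesHeegnerHypothesis N K →
        (W.quadraticTwist (NumberField.discr K : ℚ)).entireLFunction 1 ≠ 0 →
        WeierstrassCurve.Affine.Point.map ιK.toRatAlgHom P = heegnerPointComplex Dt H →
        ¬ (p : ℤ) ∣ Dt.c → ¬ IsOfFinAddOrder P →
        Odd (NumberField.discr K) →
        ∀ (κ : ZpExtension K p), κ.IsAnticyclotomic →
          ∀ (γ : Field.absoluteGaloisGroup K) [Fact (κ.IsTopGenerator γ)]
            (𝔭 : HeightOneSpectrum (𝓞 K)), ((p : ℕ) : 𝓞 K) ∈ 𝔭.asIdeal →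
            𝔭.asIdeal.ramificationIdx (𝓞 ℚ) = 1 → 𝔭.asIdeal.inertiaDeg (𝓞 ℚ) = 1 →
            ∀ (𝔭bar : HeightOneSpectrum (𝓞 K)), ((p : ℕ) : 𝓞 K) ∈ 𝔭bar.asIdeal → 𝔭bar ≠ 𝔭 →
              ((Ideal.span {(p : ℤ)}).primesOver (𝓞 K)).ncard = 2 →
            ∀ (f : CuspForm (CongruenceSubgroup.Gamma0 N) 2), IsNewformOf W f →
              ∀ (ι' : PadicAlgCl p ≃+* ℂ),
                (∀ (w : InfinitePlace K) (k : 𝓞 K),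
                  k ∈ 𝔭.asIdeal ↔ ‖ι'.symm (w.embedding (k : K))‖ < 1) →
                ∀ (ΩK : ℂ) (Ωp : ℂ_[p]) (Q : PowerSeries 𝓞_ℂ_[p]), ΩK ≠ 0 → ‖Ωp‖ = 1 →
                  R1.IsBDPLFunctionInt p ι' 𝔭 κ γ f ΩK Ωp Q →
                    ∀ (Sf : Finset (HeightOneSpectrum (𝓞 K))),
                    (∀ w : HeightOneSpectrum (𝓞 K), w ∈ Sf ↔
                      (((W.conductorNorm ℤ : ℤ) : 𝓞 K) ∈ w.asIdeal ∧ ((p : ℕ) : 𝓞 K) ∉ w.asIdeal)) →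
                    ∀ m : ℕ, ‖((PowerSeries.coeff m Q : 𝓞_ℂ_[p]) : ℂ_[p])‖ = 1 →
                      (∀ i < m, ‖((PowerSeries.coeff i Q : 𝓞_ℂ_[p]) : ℂ_[p])‖ < 1) →
                        m + ∑ w ∈ Sf, curveLocalLambda κ (W.baseChange K) w ≤
                          lambdaInvariant p (XAc (W.baseChange K) p κ 𝔭bar (↑Sf : Set (HeightOneSpectrum (𝓞 K))) γ)) := by
  sorry

/-- **stub_mazurMC_cellB** := the route decl `MazurMCOnCellB` VERBATIM (crux 3,
stmt-BirchSwinnertonDyer-19033; RULING L5 (β)). [cite: GreenbergVatsal2000, Thm. (1.3)] -/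
theorem stub_mazurMC_cellB :
    Summit.BirchSwinnertonDyer.BirchSwinnertonDyer.Theses.EisensteinPrimes.MazurMCOnCellB := by
  sorry

/-- **COMPOSITION — `BSDpOnCellC_of`: the six stubs imply crux 4 BY NAME**
(`Summit.BirchSwinnertonDyer.BirchSwinnertonDyer.Theses.EisensteinPrimes.BSDpOnCellC` = `X2.TargetC`) through this
seat's `BSDpOnCellCResidualV11.bsdpOnCellC_of_publishedFacts_of_divIntOther_of_lemma511_OPEN_of_muFrame_of_imprimitiveCount_of_cellB`
(= p613384 ∘ (p622336 `μ`-half by name, p622724 imprimitive cut ∘ p620653 f-side kernel)). No sorry outside the stubs.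
[cite: KellerYin2024, Thm. 5.1.3 = Thm. D, Lemma 5.1.1, Lemma 5.1.2 (arXiv:2402.12781v2) (shape only)]
[cite: Castella2018Exceptional, Thm. 2.10 and Thm. 2.11] [cite: Hsieh2014, Thm. 1] [cite: Miller2011LMS, Def. 1.1]
[cite: LiuZhangZhang2018, Thm. 1.5.1 and Thm. 1.5.3] -/
theorem BSDpOnCellC_of :
    Summit.BirchSwinnertonDyer.BirchSwinnertonDyer.Theses.EisensteinPrimes.BSDpOnCellC :=
  Summit.BirchSwinnertonDyer.BirchSwinnertonDyer.Theorems.BSDpOnCellCResidualV11.bsdpOnCellC_of_publishedFacts_of_divIntOther_of_lemma511_OPEN_of_muFrame_of_imprimitiveCount_of_cellB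
    stub_publishedFacts stub_divRbeta.1 stub_divRbeta.2 stub_lemma511 stub_muFrame.1 stub_muFrame.2
    stub_imprimitiveCount.1 stub_imprimitiveCount.2 stub_mazurMC_cellB

end Summit.BirchSwinnertonDyer.BirchSwinnertonDyer.Cruxes.BSDpOnCellC.B1

end
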